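import Literature.Analysis.Calculus.SeeleyExtension
import Mathlib.Analysis.InnerProductSpace.Calculus
import Mathlib.Analysis.InnerProductSpace.EuclideanDist
import HarnessLib

/-!
# Route `ExtremiserTransience`, crux `NearExtremalTransiencePerFlow` (stmt-NavierStokesRegularity-26567), LINE g10-1 «two_thirds»
# (ns-idea-10 g10), stub S2 `FirstOrderIdentity`: THIN-SHELL CUTOFFS with derivative bounds of every order

Helper file for S2 (`--supports stmt-NavierStokesRegularity-26567`).  The Euler–Lagrange test of S2 is `curl (χψ)` with `χ` a
smooth weight equal to `1` on the ball `B(c,R)` and to `0` off `B(c, R + ℓ)`, `ℓ = R^{7/8} ≪ R`, whose derivatives must obey the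
THIN-SHELL bounds `‖Dʲχ‖ ≲ ℓ^{-j}` (not `R^{-j}`, and uniformly in the large radius `R`).  This file constructs such weights for
every centre `c` and radii `0 ≤ r₁ < r₂`, with ONE universal table of constants `K n`:

* `exists_shellCutoff` — `χ = φ(−¼ − (‖x−c‖² − r₁²)/(4(r₂² − r₁²)))` with `φ` the Seeley cutoff of the tree
  (`Literature.Analysis.Calculus.Seeley.cutoff`, `φ = 1` on `[−¼, ∞)`, `φ = 0` on `(−∞, −½]`, all derivatives bounded):
  smooth, `0 ≤ χ ≤ 1`, `χ = 1` on `B̄(c,r₁)`, `χ = 0` off `B(c,r₂)`, compact support in `B̄(c,r₂)`, all derivatives of positive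
  order vanish off the shell `r₁ ≤ ‖x − c‖ ≤ r₂`, and
  `‖Dⁿχ(x)‖ ≤ n! · K n · Dⁿ` whenever `1 ≤ 2(r₂² − r₁²)D²` and `‖x − c‖ ≤ 2(r₂² − r₁²)D`
  (Faà di Bruno in the form of Mathlib's `norm_iteratedFDeriv_comp_le`: the inner map is a quadratic polynomial with
  `‖D¹‖ = ‖x−c‖/(2(r₂²−r₁²))`, `‖D²‖ ≤ 1/(2(r₂²−r₁²))`, `D³ = 0`).  For the shell `r₁ = R + ℓ/4`, `r₂ = R + 3ℓ/4` (`ℓ ≤ 2R`) and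
  `‖x − c‖ ≤ 2R` one may take `D = 1/ℓ`.

HONEST FRAMING: elementary calculus; nothing about Navier–Stokes regularity or blow-up is proved; S2, the crux ⟨26567⟩ and NS
regularity are OPEN; no summit is proved by a line. [folklore]
-/

noncomputable section

open scoped Topology ContDiff Nat RealInnerProductSpace
open Set Filter Metric
open Literature.Analysis.Calculus

namespace Summit.NavierStokesRegularity.NavierStokesRegularity.Theorems.NearExtremalTransiencePerFlow.TwoThirds

-- the summit's namespace repeats the problem name by convention (D-0017)
set_option linter.dupNamespace false

/-- The iterated derivatives of positive order of a function which is locally constant near `x` vanish at `x`. [folklore] -/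
theorem iteratedFDeriv_eq_zero_of_eventuallyEq_const {χ : (EuclideanSpace ℝ (Fin 3)) → ℝ} {x : (EuclideanSpace ℝ (Fin 3))} {a : ℝ} (h : χ =ᶠ[𝓝 x] fun _ => a)
    {n : ℕ} (hn : 1 ≤ n) : iteratedFDeriv ℝ n χ x = 0 := by
  rw [(h.iteratedFDeriv ℝ n).eq_of_nhds, iteratedFDeriv_const_of_ne (by omega)]
  rfl

/-- **THIN-SHELL CUTOFFS.**  There is a universal table `K : ℕ → ℝ` of nonnegative constants such that for every centre `c` and
radii `0 ≤ r₁ < r₂` there is a smooth `χ : (EuclideanSpace ℝ (Fin 3)) → [0,1]` with `χ = 1` on `B̄(c,r₁)`, `χ = 0` off `B(c,r₂)`, compact support inside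
`B̄(c,r₂)`, all derivatives of positive order vanishing off the closed shell `r₁ ≤ ‖x−c‖ ≤ r₂`, and the derivative bounds
`‖Dⁿχ(x)‖ ≤ n!·K n·Dⁿ` for every `D ≥ 0` with `1 ≤ 2(r₂² − r₁²)D²`, at every `x` with `‖x − c‖ ≤ 2(r₂² − r₁²)D`. [folklore] -/
theorem exists_shellCutoff :
    ∃ K : ℕ → ℝ, (∀ n, 0 ≤ K n) ∧
      ∀ (c : (EuclideanSpace ℝ (Fin 3))) (r₁ r₂ : ℝ), 0 ≤ r₁ → r₁ < r₂ →
        ∃ χ : (EuclideanSpace ℝ (Fin 3)) → ℝ, ContDiff ℝ (⊤ : ℕ∞) χ ∧ (∀ x, 0 ≤ χ x ∧ χ x ≤ 1) ∧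
          (∀ x, ‖x - c‖ ≤ r₁ → χ x = 1) ∧ (∀ x, r₂ ≤ ‖x - c‖ → χ x = 0) ∧
          HasCompactSupport χ ∧ tsupport χ ⊆ closedBall c r₂ ∧
          (∀ (n : ℕ) (x : (EuclideanSpace ℝ (Fin 3))), 1 ≤ n → ‖x - c‖ < r₁ → iteratedFDeriv ℝ n χ x = 0) ∧
          (∀ (n : ℕ) (x : (EuclideanSpace ℝ (Fin 3))), 1 ≤ n → r₂ < ‖x - c‖ → iteratedFDeriv ℝ n χ x = 0) ∧
          (∀ (n : ℕ) (D : ℝ) (x : (EuclideanSpace ℝ (Fin 3))), 0 ≤ D → 1 ≤ 2 * (r₂ ^ 2 - r₁ ^ 2) * D ^ 2 →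
            ‖x - c‖ ≤ 2 * (r₂ ^ 2 - r₁ ^ 2) * D → ‖iteratedFDeriv ℝ n χ x‖ ≤ n ! * K n * D ^ n) := by
  refine ⟨fun n => ∑ i ∈ Finset.range (n + 1), Seeley.cutoffBound i,
    fun n => Finset.sum_nonneg fun i _ => Seeley.cutoffBound_nonneg i, fun c r₁ r₂ h0 h12 => ?_⟩
  -- the shell parameters
  have hr₂ : 0 < r₂ := lt_of_le_of_lt h0 h12
  set w : ℝ := r₂ ^ 2 - r₁ ^ 2 with hw
  have hw0 : 0 < w := by rw [hw]; nlinarith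
  set κ : ℝ := -(1 / (4 * w)) with hκ
  set μ : ℝ := -1 / 4 + r₁ ^ 2 / (4 * w) with hμ
  -- the quadratic inner map
  set N : (EuclideanSpace ℝ (Fin 3)) → ℝ := fun x => ‖x - c‖ ^ 2 with hN
  set f : (EuclideanSpace ℝ (Fin 3)) → ℝ := fun x => κ * N x + μ with hf
  have hNs : ContDiff ℝ (⊤ : ℕ∞) N := (contDiff_norm_sq ℝ).comp (contDiff_id.sub contDiff_const)
  have hfs : ContDiff ℝ (⊤ : ℕ∞) f := (contDiff_const.mul hNs).add contDiff_const
  -- the cutoff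
  set χ : (EuclideanSpace ℝ (Fin 3)) → ℝ := fun x => Seeley.cutoff (f x) with hχ
  have hχs : ContDiff ℝ (⊤ : ℕ∞) χ := Seeley.contDiff_cutoff.comp hfs
  -- the value of `f` in terms of the radius
  have hf_eq : ∀ x, f x = -1 / 4 + (r₁ ^ 2 - ‖x - c‖ ^ 2) / (4 * w) := fun x => by
    simp only [hf, hκ, hμ, hN]
    field_simp
    ring
  have hone : ∀ x, ‖x - c‖ ≤ r₁ → χ x = 1 := by
    intro x hx
    have h1 : ‖x - c‖ ^ 2 ≤ r₁ ^ 2 := pow_le_pow_left₀ (norm_nonneg _) hx 2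
    have h2 : 0 ≤ (r₁ ^ 2 - ‖x - c‖ ^ 2) / (4 * w) := div_nonneg (by linarith) (by positivity)
    exact Seeley.cutoff_of_ge (by rw [hf_eq]; linarith)
  have hzero : ∀ x, r₂ ≤ ‖x - c‖ → χ x = 0 := by
    intro x hx
    have h1 : r₂ ^ 2 ≤ ‖x - c‖ ^ 2 := pow_le_pow_left₀ hr₂.le hx 2
    have h2 : (r₁ ^ 2 - ‖x - c‖ ^ 2) / (4 * w) ≤ -1 / 4 := by
      rw [div_le_iff₀ (by positivity)]
      have : r₁ ^ 2 - ‖x - c‖ ^ 2 ≤ -w := by rw [hw]; linarith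
      linarith
    exact Seeley.cutoff_of_le (by rw [hf_eq]; linarith)
  have htsupp : tsupport χ ⊆ closedBall c r₂ := by
    refine closure_minimal (fun x hx => ?_) isClosed_closedBall
    rw [mem_closedBall, dist_eq_norm]
    by_contra h
    exact hx (hzero x (not_le.1 h).le)
  have hcs : HasCompactSupport χ :=
    HasCompactSupport.of_support_subset_isCompact (isCompact_closedBall c r₂)
      (subset_tsupport χ |>.trans htsupp)
  -- local constancy off the shell
  have hin : ∀ (n : ℕ) (x : (EuclideanSpace ℝ (Fin 3))), 1 ≤ n → ‖x - c‖ < r₁ → iteratedFDeriv ℝ n χ x = 0 := by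
    intro n x hn hx
    refine iteratedFDeriv_eq_zero_of_eventuallyEq_const (a := 1) ?_ hn
    have hopen : IsOpen {y : (EuclideanSpace ℝ (Fin 3)) | ‖y - c‖ < r₁} := isOpen_lt (continuous_id.sub continuous_const).norm continuous_const
    filter_upwards [hopen.mem_nhds hx] with y hy
    exact hone y (le_of_lt hy)
  have hout : ∀ (n : ℕ) (x : (EuclideanSpace ℝ (Fin 3))), 1 ≤ n → r₂ < ‖x - c‖ → iteratedFDeriv ℝ n χ x = 0 := by
    intro n x hn hx
    refine iteratedFDeriv_eq_zero_of_eventuallyEq_const (a := 0) ?_ hn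
    have hopen : IsOpen {y : (EuclideanSpace ℝ (Fin 3)) | r₂ < ‖y - c‖} := isOpen_lt continuous_const (continuous_id.sub continuous_const).norm
    filter_upwards [hopen.mem_nhds hx] with y hy
    exact hzero y (le_of_lt hy)
  -- the derivatives of the inner map
  set L : (EuclideanSpace ℝ (Fin 3)) →L[ℝ] (EuclideanSpace ℝ (Fin 3)) →L[ℝ] ℝ := (2 * κ) • (innerSL ℝ : (EuclideanSpace ℝ (Fin 3)) →L[ℝ] (EuclideanSpace ℝ (Fin 3)) →L[ℝ] ℝ) with hL
  have hDN : ∀ x, HasFDerivAt N ((2 : ℕ) • innerSL ℝ (x - c)) x := by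
    intro x
    have h := ((hasStrictFDerivAt_norm_sq (x - c)).hasFDerivAt).comp x (hasFDerivAt_sub_const c)
    rw [ContinuousLinearMap.comp_id] at h
    exact h
  have hDf : ∀ x, HasFDerivAt f (L (x - c)) x := by
    intro x
    have h := ((hDN x).const_mul κ).add_const μ
    have e : κ • ((2 : ℕ) • innerSL ℝ (x - c)) = L (x - c) := by
      rw [hL, FunLike.coe_smul, Pi.smul_apply, ← Nat.cast_smul_eq_nsmul ℝ, smul_smul, Nat.cast_ofNat, mul_comm]
    rw [e] at h
    exact h
  have hfd : fderiv ℝ f = fun x => L (x - c) := funext fun x => (hDf x).fderiv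
  have hDDf : ∀ x, HasFDerivAt (fderiv ℝ f) L x := by
    intro x
    rw [hfd]
    have h := L.hasFDerivAt.comp x (hasFDerivAt_sub_const c)
    rwa [ContinuousLinearMap.comp_id] at h
  have hfdd : fderiv ℝ (fderiv ℝ f) = fun _ => L := funext fun x => (hDDf x).fderiv
  have h2κ : |2 * κ| = 1 / (2 * w) := by
    rw [hκ, show (2 : ℝ) * -(1 / (4 * w)) = -(1 / (2 * w)) by ring, abs_neg, abs_of_pos (by positivity)]
  have hLnorm : ‖L‖ ≤ 1 / (2 * w) := by
    rw [← h2κ]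
    refine ContinuousLinearMap.opNorm_le_bound _ (abs_nonneg _) fun v => ?_
    refine ContinuousLinearMap.opNorm_le_bound _ (by positivity) fun u => ?_
    simp only [hL, FunLike.coe_smul, Pi.smul_apply, smul_eq_mul, Real.norm_eq_abs]
    rw [abs_mul]
    calc |2 * κ| * |⟪v, u⟫| ≤ |2 * κ| * (‖v‖ * ‖u‖) :=
          mul_le_mul_of_nonneg_left (abs_real_inner_le_norm v u) (abs_nonneg _)
      _ = |2 * κ| * ‖v‖ * ‖u‖ := by ring
  have hD1 : ∀ x, ‖iteratedFDeriv ℝ 1 f x‖ ≤ ‖x - c‖ / (2 * w) := by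
    intro x
    rw [norm_iteratedFDeriv_one, (hDf x).fderiv]
    calc ‖L (x - c)‖ ≤ ‖L‖ * ‖x - c‖ := L.le_opNorm _
      _ ≤ 1 / (2 * w) * ‖x - c‖ := mul_le_mul_of_nonneg_right hLnorm (norm_nonneg _)
      _ = ‖x - c‖ / (2 * w) := by ring
  have hD2 : ∀ x, ‖iteratedFDeriv ℝ 2 f x‖ ≤ 1 / (2 * w) := by
    intro x
    rw [← norm_iteratedFDeriv_fderiv, norm_iteratedFDeriv_one, (hDDf x).fderiv]
    exact hLnorm
  have hD3 : ∀ (j : ℕ) x, iteratedFDeriv ℝ (j + 3) f x = 0 := by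
    intro j x
    have h1 : ‖iteratedFDeriv ℝ (j + 3) f x‖ = 0 := by
      rw [show j + 3 = (j + 1) + 1 + 1 by ring, ← norm_iteratedFDeriv_fderiv, ← norm_iteratedFDeriv_fderiv, hfdd,
        iteratedFDeriv_const_of_ne (by omega)]
      simp
    exact norm_eq_zero.1 h1
  -- the derivative bounds
  have hbound : ∀ (n : ℕ) (D : ℝ) (x : (EuclideanSpace ℝ (Fin 3))), 0 ≤ D → 1 ≤ 2 * w * D ^ 2 → ‖x - c‖ ≤ 2 * w * D →
      ‖iteratedFDeriv ℝ n χ x‖ ≤ n ! * (∑ i ∈ Finset.range (n + 1), Seeley.cutoffBound i) * D ^ n := by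
    intro n D x hD0 hD2w hxD
    have hC : ∀ i, i ≤ n → ‖iteratedFDeriv ℝ i Seeley.cutoff (f x)‖ ≤ ∑ j ∈ Finset.range (n + 1), Seeley.cutoffBound j := by
      intro i hi
      refine (Seeley.norm_iteratedFDeriv_cutoff_le i (f x)).trans ?_
      exact Finset.single_le_sum (f := fun j => Seeley.cutoffBound j) (fun j _ => Seeley.cutoffBound_nonneg j)
        (Finset.mem_range.2 (Nat.lt_succ_of_le hi))
    have hDi : ∀ i, 1 ≤ i → i ≤ n → ‖iteratedFDeriv ℝ i f x‖ ≤ D ^ i := by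
      intro i hi _
      rcases Nat.lt_or_ge i 3 with h3 | h3
      · interval_cases i
        · refine (hD1 x).trans ?_
          rw [pow_one, div_le_iff₀ (by positivity)]
          linarith
        · refine (hD2 x).trans ?_
          rw [div_le_iff₀ (by positivity)]
          linarith
      · obtain ⟨j, rfl⟩ : ∃ j, i = j + 3 := ⟨i - 3, by omega⟩
        rw [hD3 j x, norm_zero]
        positivity
    have h := norm_iteratedFDeriv_comp_le (g := Seeley.cutoff) (f := f) (n := n) (N := ((⊤ : ℕ∞) : ℕ∞ω))
      Seeley.contDiff_cutoff hfs (by exact_mod_cast le_top) x hC hDi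
    exact h
  exact ⟨χ, hχs, fun x => ⟨Seeley.cutoff_nonneg _, Seeley.cutoff_le_one _⟩, hone, hzero, hcs, htsupp, hin, hout,
    fun n D x hD0 hD2 hxD => hbound n D x hD0 hD2 hxD⟩

end Summit.NavierStokesRegularity.NavierStokesRegularity.Theorems.NearExtremalTransiencePerFlow.TwoThirds

end
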